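import Mathlib
import HarnessLib
import Summits.HubbardSuperconductivity.HubbardSuperconductivity.Theorems.KLProgrammeKLRegimeEnginePairTransferMemberPHProfile
import Summits.HubbardSuperconductivity.HubbardSuperconductivity.Theorems.KLProgrammeKLRegimeEngineAngularMass

/-!
# Route `KLProgramme` — ENGINE item stmt-HubbardSuperconductivity-20437 `KLRegimeEngineV17F2`, class-#5 STEP (X).3, candidate order «54b-RESOLVED»: «PH-PROFILE» IN LAYER-CAKE
# FORM and the CONVOLVED member PH rows `Σ_c ρ(c)·Wd_j(x,c)`, `Σ_c ρ(c)·Wx_j(x,c)` against a WINDOWED weight (cell gate-hubbard-kl, seat hubbard-kl-k3c2-p2 g17)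

WHY.  In the resolved class-#5 STEP (k3c1-p1 g15 «(X).3-RESOLVED-STEP», (R200)) the member particle–hole masses enter only as `m·Σ_c ‖S₁(x,c)‖·ᾱ(c)` and its mirror,
i.e. — after `klmd_defect_le_masses_family` — as `Σ_c ρ(c)·(Λₙ−Λₙ₊₁)((βL²)³)⁻¹·Wd_j(t,x,c)` (+ crossed, + mirror) with `ρ = M4²·ᾱ ≥ 0` a weight whose WINDOWED masses
`Σ_{|c−x₀|_𝕋 ≤ η} ρ(c) ≤ A_w·η` (`η ≥ η₀`) and total `Σρ ≤ Z` are p1's (W2) rows («(ᾱ)-WINDOW»).  The dyadic layer cake `klam_sum_mul_profile_le` (…EngineAngularMass, p496685)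
wants the profile as `φ ≤ Φ₀` everywhere and `φ ≤ C/d + f` off the centre.  This file supplies exactly that and runs it:
* §1 `Wd_member_row_le_div` / `Wx_member_row_le_div`: for `0 < r` (`r` = torus norm of the transfer),
  `(Λₙ−Λₙ₊₁)((βL²)³)⁻¹·W ≤ C/r + f`, `C = (c·K·16384·G² + F/(8G))·Λₙ₊₁`, `f = c·K·(√2/4)·2⁻ⁿ`, `K = (27/(8π²))·A·(16/π)·(10+50Gβ/L)`, `(c, F) = (512/3, 2048·15367)` direct /
  `(256/3, 1024·15367)` crossed (below the threshold `G·r < Λₙ₊₁/8` the flat core is `≤ F ≤ (F·Λₙ₊₁/(8G))/r`; above it the tail's `min ≤ Λₙ₊₁/r`);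
* §2 the CONVOLVED ROWS (`klam_sum_mul_profile_le` at `r₀ = Λₙ₊₁`, `η₀ ≤ Λₙ₊₁`, any shell number `I`):
  `Σ_c ρ(c)·row(x,c) ≤ F·A_w·Λₙ₊₁ + f·Z + 2·A_w·C·I + C·Z/(Λₙ₊₁·2^I)` — `Wd_member_conv_le` (transfer `x − c`, window centre `x`), `Wd_member_conv_le'` (mirror `row(c,y)`, centre `y`),
  `Wx_member_conv_le` (transfer `x + c − Qm`, centre `Qm − x`), `Wx_member_conv_le'` (mirror, centre `Qm − y`).
SIZE [paper]: with `I = 2n+2`, `A_w ∝ M_D`, `Z ∝ M_D` this is `M_D × (Λₙ₊₁·(F + n·K·G²) + K·2⁻ⁿ + (K·G² + F/G)·4^{−(n+1)})` — the ROOM's slot types; constants against `r`, not `2ⁿ`.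
Real analysis over landed lemmas; nothing about the model's sizes is asserted; nothing asserts (X).3, (c), K3 or superconductivity.  0 kit · 0 lit.
-/

noncomputable section

namespace Summit.HubbardSuperconductivity.HubbardSuperconductivity.Theorems.KLRegimeSplit

set_option linter.dupNamespace false -- summit = problem name (single-conjunct summit), D-0017

open Real Finset Set Literature.MathematicalPhysics.QuantumLattice Literature.Probability.LatticeModels
open Literature.MathematicalPhysics.QuantumLattice.FermiRG
open Summit.HubbardSuperconductivity.HubbardSuperconductivity.Theorems.KLProgrammeLegKernels
open Summit.HubbardSuperconductivity.HubbardSuperconductivity.Theorems.TwoPointAssembly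
open Summit.HubbardSuperconductivity.HubbardSuperconductivity.Theorems.DispersionFlow
open Summit.HubbardSuperconductivity.HubbardSuperconductivity.Theorems.KLRegimeWick
open Summit.HubbardSuperconductivity.HubbardSuperconductivity.Theorems.EngineV8
open Summit.HubbardSuperconductivity.HubbardSuperconductivity.Theorems.PerturbedFermiCurve

/-- `a·min(r/Λ₁, Λ₁/r) ≤ (a·Λ₁)/r` (`0 ≤ a`). -/
theorem mul_min_le_div {a r Λ₁ : ℝ} (ha : 0 ≤ a) : a * min (r / Λ₁) (Λ₁ / r) ≤ a * Λ₁ / r := by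
  rw [mul_div_assoc]; exact mul_le_mul_of_nonneg_left (min_le_right _ _) ha

/-- Below the threshold the flat core is under the `1/r` tail: `F ≤ (F·Λ₁/(8G))/r` for `0 < r`, `G·r < Λ₁/8`, `0 < G`, `0 ≤ F`. -/
theorem flat_le_div_of_small {F G r Λ₁ : ℝ} (hF : 0 ≤ F) (hG : 0 < G) (hr : 0 < r) (h : G * r < Λ₁ / 8) : F ≤ F * Λ₁ / (8 * G) / r := by
  rw [le_div_iff₀ hr, mul_div_assoc]
  refine mul_le_mul_of_nonneg_left ?_ hF
  rw [le_div_iff₀ (by positivity)]; linarith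

/-! ## §1 The profile in layer-cake form: `≤ C/r + f` off the centre -/

/-- **«PH-PROFILE», direct, layer-cake form**: for `0 < r = |x−y|_𝕋`, `(Λₙ−Λₙ₊₁)((βL²)³)⁻¹·Wd_j(t,x,y) ≤ C/r + f` with
`C = ((512/3)·K·16384·G² + 2048·15367/(8G))·Λₙ₊₁`, `f = (512/3)·K·(√2/4)·2⁻ⁿ`, `K = (27/(8π²))·A·(16/π)·(10+50Gβ/L)`. -/
theorem Wd_member_row_le_div {L M : ℕ} [NeZero L] [NeZero M] (β μ : ℝ) (K : TrigPolyC4v) {A : ℝ} {u : RenConsts → ℝ} (h : TwoShellFrameAreaAt A u)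
    (hA : 0 ≤ A) {R : RenConsts} (hR : R.WF2) {U : ℝ} (hU : 0 < U) (hUu : U ≤ u R) (hμ : μ ∈ klWindowC) {N : ℕ} (hK : FrameOK R U N μ K)
    (hβm : klBetaMin ≤ β) (hβL : β ≤ L) (n : ℕ) {j : ℕ} (hj : n + 1 ≤ j) (hj'β : π / (4 * β) ≤ klScale klE0 (n + 1)) {t : ℝ} (ht : t ∈ Icc (0 : ℝ) 1)
    (hGδ : (4 + 8 / 3 * R.Gfr 1 * U ^ 2) * (2 * π / L) ≤ klScale klE0 (n + 1))
    (hE0 : 2 * klScale klE0 n + (4 + 8 / 3 * R.Gfr 1 * U ^ 2) * (2 * π / L) ≤ klE0) {x y : TorusSite 2 L}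
    (hr : 0 < klTorusNorm L (x - y)) :
    (klScale klE0 n - klScale klE0 (n + 1)) * ((β * (L : ℝ) ^ 2) ^ 3)⁻¹ *
      ∑ p : FreqMomentum L M, ∑ _σ : Fin 2, ∑ p' : FreqMomentum L M,
        (if matsubaraInt M p'.1 + matsubaraInt M (omega0 M) = matsubaraInt M p.1 + matsubaraInt M (omega0 M) ∧ p'.2 = p.2 + x - y then
          ‖((((softSymbolCompl L M β μ K (n + 1) j p + (hubbardCutoffWeightCT L M β μ K (klScale klE0 (n + 1)) p -
                hubbardCutoffWeightCT L M β μ K (klScale klE0 n + t * (klScale klE0 (n + 1) - klScale klE0 n)) p) : ℝ)) : ℂ) *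
                (((β * (L : ℝ) ^ 2 : ℝ) : ℂ) * propCT L M β μ K p)) *
              ((((deriv (fun Λ' : ℝ => hubbardCutoffWeightCT L M β μ K Λ' p') (klScale klE0 n + t * (klScale klE0 (n + 1) - klScale klE0 n)) : ℝ)) : ℂ) *
                (((β * (L : ℝ) ^ 2 : ℝ) : ℂ) * propCT L M β μ K p')) +
            ((((deriv (fun Λ' : ℝ => hubbardCutoffWeightCT L M β μ K Λ' p) (klScale klE0 n + t * (klScale klE0 (n + 1) - klScale klE0 n)) : ℝ)) : ℂ) *
                (((β * (L : ℝ) ^ 2 : ℝ) : ℂ) * propCT L M β μ K p)) *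
              ((((softSymbolCompl L M β μ K (n + 1) j p' + (hubbardCutoffWeightCT L M β μ K (klScale klE0 (n + 1)) p' -
                hubbardCutoffWeightCT L M β μ K (klScale klE0 n + t * (klScale klE0 (n + 1) - klScale klE0 n)) p') : ℝ)) : ℂ) *
                (((β * (L : ℝ) ^ 2 : ℝ) : ℂ) * propCT L M β μ K p'))‖
        else 0) ≤
      (512 / 3 * ((27 / (8 * π ^ 2)) * A * (16 / π) * (10 + 50 * (4 + 8 / 3 * R.Gfr 1 * U ^ 2) * β / L)) * (16384 * (4 + 8 / 3 * R.Gfr 1 * U ^ 2) ^ 2) + (2048 * 15367 : ℝ) / (8 * (4 + 8 / 3 * R.Gfr 1 * U ^ 2))) * klScale klE0 (n + 1) / klTorusNorm L (x - y) +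
        512 / 3 * ((27 / (8 * π ^ 2)) * A * (16 / π) * (10 + 50 * (4 + 8 / 3 * R.Gfr 1 * U ^ 2) * β / L)) * (Real.sqrt 2 / 4 * ((2 : ℝ) ^ n)⁻¹) := by
  have hπ := Real.pi_pos
  have hβ : 0 < β := pos_of_klBetaMin_le hβm
  have hL : (0 : ℝ) < L := by exact_mod_cast Nat.pos_of_ne_zero (NeZero.ne L)
  have hGfr : ∀ j, 0 ≤ R.Gfr j := hR.wf.2.2
  have hG1 : 0 ≤ R.Gfr 1 := hGfr 1
  set G : ℝ := 4 + 8 / 3 * R.Gfr 1 * U ^ 2 with hG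
  have hG4 : 4 ≤ G := by rw [hG]; nlinarith [hGfr 1, sq_nonneg U]
  have hG0 : 0 < G := by linarith
  have hΛ1 : 0 < klScale klE0 (n + 1) := klth_klScale_pos (n + 1)
  set r : ℝ := klTorusNorm L (x - y) with hrdef
  have hKc0 : 0 ≤ (27 / (8 * π ^ 2)) * A * (16 / π) * (10 + 50 * G * β / L) := by positivity
  set Kc : ℝ := (27 / (8 * π ^ 2)) * A * (16 / π) * (10 + 50 * G * β / L) with hKc
  have hC1 : 0 ≤ 512 / 3 * Kc * (16384 * G ^ 2) * klScale klE0 (n + 1) / r := by positivity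
  have hC2 : 0 ≤ (2048 * 15367 : ℝ) / (8 * G) * klScale klE0 (n + 1) / r := by positivity
  have hf : 0 ≤ 512 / 3 * Kc * (Real.sqrt 2 / 4 * ((2 : ℝ) ^ n)⁻¹) := by positivity
  have hsplit : (512 / 3 * Kc * (16384 * G ^ 2) + (2048 * 15367 : ℝ) / (8 * G)) * klScale klE0 (n + 1) / r =
      512 / 3 * Kc * (16384 * G ^ 2) * klScale klE0 (n + 1) / r + (2048 * 15367 : ℝ) / (8 * G) * klScale klE0 (n + 1) / r := by ring
  rw [hsplit]
  by_cases hlt : G * r < klScale klE0 (n + 1) / 8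
  · have hflat := Wd_member_row_flat_le (L := L) (M := M) β μ K hK hβm hβL n hj ht x y
    have hF : (2048 * 15367 : ℝ) ≤ (2048 * 15367 : ℝ) * klScale klE0 (n + 1) / (8 * G) / r := flat_le_div_of_small (by norm_num) hG0 hr hlt
    have e : (2048 * 15367 : ℝ) * klScale klE0 (n + 1) / (8 * G) / r = (2048 * 15367 : ℝ) / (8 * G) * klScale klE0 (n + 1) / r := by ring
    rw [e] at hF
    linarith
  · have hge : klScale klE0 (n + 1) / 8 ≤ G * r := not_lt.1 hlt
    have h0 := Wd_member_row_le_slots (L := L) (M := M) β μ K h hA hR hU hUu hμ hK hβ n hj hj'β ht hGδ hE0 hge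
    have hmin : 512 / 3 * Kc * (16384 * G ^ 2) * min (r / klScale klE0 (n + 1)) (klScale klE0 (n + 1) / r) ≤
        512 / 3 * Kc * (16384 * G ^ 2) * klScale klE0 (n + 1) / r := mul_min_le_div (by positivity)
    calc _ ≤ 512 / 3 * (27 / (8 * π ^ 2)) * A * (16 / π) * (10 + 50 * G * β / L) *
          (16384 * G ^ 2 * min (r / klScale klE0 (n + 1)) (klScale klE0 (n + 1) / r) + Real.sqrt 2 / 4 * ((2 : ℝ) ^ n)⁻¹) := h0
      _ = 512 / 3 * Kc * (16384 * G ^ 2) * min (r / klScale klE0 (n + 1)) (klScale klE0 (n + 1) / r) + 512 / 3 * Kc * (Real.sqrt 2 / 4 * ((2 : ℝ) ^ n)⁻¹) := by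
          rw [hKc]; ring
      _ ≤ 512 / 3 * Kc * (16384 * G ^ 2) * klScale klE0 (n + 1) / r + 512 / 3 * Kc * (Real.sqrt 2 / 4 * ((2 : ℝ) ^ n)⁻¹) := add_le_add hmin le_rfl
      _ ≤ _ := by linarith

/-- **«PH-PROFILE», crossed, layer-cake form**: for `0 < r = |x+y−Qm|_𝕋`, `(Λₙ−Λₙ₊₁)((βL²)³)⁻¹·Wx_j(t,x,y) ≤ C/r + f` with the crossed constants
`(256/3, 1024·15367)`. -/
theorem Wx_member_row_le_div {L M : ℕ} [NeZero L] [NeZero M] (β μ : ℝ) (K : TrigPolyC4v) {A : ℝ} {u : RenConsts → ℝ} (h : TwoShellFrameAreaAt A u)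
    (hA : 0 ≤ A) {R : RenConsts} (hR : R.WF2) {U : ℝ} (hU : 0 < U) (hUu : U ≤ u R) (hμ : μ ∈ klWindowC) {N : ℕ} (hK : FrameOK R U N μ K)
    (hβm : klBetaMin ≤ β) (hβL : β ≤ L) (n : ℕ) {j : ℕ} (hj : n + 1 ≤ j) (hj'β : π / (4 * β) ≤ klScale klE0 (n + 1)) {t : ℝ} (ht : t ∈ Icc (0 : ℝ) 1)
    (hGδ : (4 + 8 / 3 * R.Gfr 1 * U ^ 2) * (2 * π / L) ≤ klScale klE0 (n + 1))
    (hE0 : 2 * klScale klE0 n + (4 + 8 / 3 * R.Gfr 1 * U ^ 2) * (2 * π / L) ≤ klE0) {Qm x y : TorusSite 2 L}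
    (hr : 0 < klTorusNorm L (x + y - Qm)) :
    (klScale klE0 n - klScale klE0 (n + 1)) * ((β * (L : ℝ) ^ 2) ^ 3)⁻¹ *
      ∑ p : FreqMomentum L M, ∑ p' : FreqMomentum L M,
        (if matsubaraInt M p'.1 + matsubaraInt M (omega0 M) + matsubaraInt M (omega0 M) + 1 = matsubaraInt M p.1 ∧ p'.2 = p.2 + Qm - x - y then
          ‖((((softSymbolCompl L M β μ K (n + 1) j p + (hubbardCutoffWeightCT L M β μ K (klScale klE0 (n + 1)) p -
                hubbardCutoffWeightCT L M β μ K (klScale klE0 n + t * (klScale klE0 (n + 1) - klScale klE0 n)) p) : ℝ)) : ℂ) *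
                (((β * (L : ℝ) ^ 2 : ℝ) : ℂ) * propCT L M β μ K p)) *
              ((((deriv (fun Λ' : ℝ => hubbardCutoffWeightCT L M β μ K Λ' p') (klScale klE0 n + t * (klScale klE0 (n + 1) - klScale klE0 n)) : ℝ)) : ℂ) *
                (((β * (L : ℝ) ^ 2 : ℝ) : ℂ) * propCT L M β μ K p')) +
            ((((deriv (fun Λ' : ℝ => hubbardCutoffWeightCT L M β μ K Λ' p) (klScale klE0 n + t * (klScale klE0 (n + 1) - klScale klE0 n)) : ℝ)) : ℂ) *
                (((β * (L : ℝ) ^ 2 : ℝ) : ℂ) * propCT L M β μ K p)) *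
              ((((softSymbolCompl L M β μ K (n + 1) j p' + (hubbardCutoffWeightCT L M β μ K (klScale klE0 (n + 1)) p' -
                hubbardCutoffWeightCT L M β μ K (klScale klE0 n + t * (klScale klE0 (n + 1) - klScale klE0 n)) p') : ℝ)) : ℂ) *
                (((β * (L : ℝ) ^ 2 : ℝ) : ℂ) * propCT L M β μ K p'))‖
        else 0) ≤
      (256 / 3 * ((27 / (8 * π ^ 2)) * A * (16 / π) * (10 + 50 * (4 + 8 / 3 * R.Gfr 1 * U ^ 2) * β / L)) * (16384 * (4 + 8 / 3 * R.Gfr 1 * U ^ 2) ^ 2) + (1024 * 15367 : ℝ) / (8 * (4 + 8 / 3 * R.Gfr 1 * U ^ 2))) * klScale klE0 (n + 1) / klTorusNorm L (x + y - Qm) +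
        256 / 3 * ((27 / (8 * π ^ 2)) * A * (16 / π) * (10 + 50 * (4 + 8 / 3 * R.Gfr 1 * U ^ 2) * β / L)) * (Real.sqrt 2 / 4 * ((2 : ℝ) ^ n)⁻¹) := by
  have hπ := Real.pi_pos
  have hβ : 0 < β := pos_of_klBetaMin_le hβm
  have hL : (0 : ℝ) < L := by exact_mod_cast Nat.pos_of_ne_zero (NeZero.ne L)
  have hGfr : ∀ j, 0 ≤ R.Gfr j := hR.wf.2.2
  have hG1 : 0 ≤ R.Gfr 1 := hGfr 1
  set G : ℝ := 4 + 8 / 3 * R.Gfr 1 * U ^ 2 with hG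
  have hG4 : 4 ≤ G := by rw [hG]; nlinarith [hGfr 1, sq_nonneg U]
  have hG0 : 0 < G := by linarith
  have hΛ1 : 0 < klScale klE0 (n + 1) := klth_klScale_pos (n + 1)
  set r : ℝ := klTorusNorm L (x + y - Qm) with hrdef
  have hKc0 : 0 ≤ (27 / (8 * π ^ 2)) * A * (16 / π) * (10 + 50 * G * β / L) := by positivity
  set Kc : ℝ := (27 / (8 * π ^ 2)) * A * (16 / π) * (10 + 50 * G * β / L) with hKc
  have hC1 : 0 ≤ 256 / 3 * Kc * (16384 * G ^ 2) * klScale klE0 (n + 1) / r := by positivity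
  have hC2 : 0 ≤ (1024 * 15367 : ℝ) / (8 * G) * klScale klE0 (n + 1) / r := by positivity
  have hf : 0 ≤ 256 / 3 * Kc * (Real.sqrt 2 / 4 * ((2 : ℝ) ^ n)⁻¹) := by positivity
  have hsplit : (256 / 3 * Kc * (16384 * G ^ 2) + (1024 * 15367 : ℝ) / (8 * G)) * klScale klE0 (n + 1) / r =
      256 / 3 * Kc * (16384 * G ^ 2) * klScale klE0 (n + 1) / r + (1024 * 15367 : ℝ) / (8 * G) * klScale klE0 (n + 1) / r := by ring
  rw [hsplit]
  by_cases hlt : G * r < klScale klE0 (n + 1) / 8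
  · have hflat := Wx_member_row_flat_le (L := L) (M := M) β μ K hK hβm hβL n hj ht Qm x y
    have hF : (1024 * 15367 : ℝ) ≤ (1024 * 15367 : ℝ) * klScale klE0 (n + 1) / (8 * G) / r := flat_le_div_of_small (by norm_num) hG0 hr hlt
    have e : (1024 * 15367 : ℝ) * klScale klE0 (n + 1) / (8 * G) / r = (1024 * 15367 : ℝ) / (8 * G) * klScale klE0 (n + 1) / r := by ring
    rw [e] at hF
    linarith
  · have hge : klScale klE0 (n + 1) / 8 ≤ G * r := not_lt.1 hlt
    have h0 := Wx_member_row_le_slots (L := L) (M := M) β μ K h hA hR hU hUu hμ hK hβ n hj hj'β ht hGδ hE0 hge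
    have hmin : 256 / 3 * Kc * (16384 * G ^ 2) * min (r / klScale klE0 (n + 1)) (klScale klE0 (n + 1) / r) ≤
        256 / 3 * Kc * (16384 * G ^ 2) * klScale klE0 (n + 1) / r := mul_min_le_div (by positivity)
    calc _ ≤ 256 / 3 * (27 / (8 * π ^ 2)) * A * (16 / π) * (10 + 50 * G * β / L) *
          (16384 * G ^ 2 * min (r / klScale klE0 (n + 1)) (klScale klE0 (n + 1) / r) + Real.sqrt 2 / 4 * ((2 : ℝ) ^ n)⁻¹) := h0
      _ = 256 / 3 * Kc * (16384 * G ^ 2) * min (r / klScale klE0 (n + 1)) (klScale klE0 (n + 1) / r) + 256 / 3 * Kc * (Real.sqrt 2 / 4 * ((2 : ℝ) ^ n)⁻¹) := by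
          rw [hKc]; ring
      _ ≤ 256 / 3 * Kc * (16384 * G ^ 2) * klScale klE0 (n + 1) / r + 256 / 3 * Kc * (Real.sqrt 2 / 4 * ((2 : ℝ) ^ n)⁻¹) := add_le_add hmin le_rfl
      _ ≤ _ := by linarith

/-! ## §2 The CONVOLVED member PH rows against a windowed weight (dyadic layer cake `klam_sum_mul_profile_le` at `r₀ = Λₙ₊₁`) -/

/-- **CONVOLVED member direct PH row** (transfer `x − c`, window centre `x`): for a weight `ρ ≥ 0` on the torus with windowed masses `Σ_{|c−x|_𝕋 ≤ η} ρ(c) ≤ A_w·η`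
(`η ≥ η₀`, `η₀ ≤ Λₙ₊₁`) and `Σρ ≤ Z`, and any shell number `I`:
`Σ_c ρ(c)·(Λₙ−Λₙ₊₁)((βL²)³)⁻¹·Wd_j(t,x,c) ≤ F·A_w·Λₙ₊₁ + f·Z + 2·A_w·C·I + C·Z/(Λₙ₊₁·2^I)` (`F = 2048·15367`, `C`, `f` of `Wd_member_row_le_div`). -/
theorem Wd_member_conv_le {L M : ℕ} [NeZero L] [NeZero M] (β μ : ℝ) (K : TrigPolyC4v) {A : ℝ} {u : RenConsts → ℝ} (h : TwoShellFrameAreaAt A u)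
    (hA : 0 ≤ A) {R : RenConsts} (hR : R.WF2) {U : ℝ} (hU : 0 < U) (hUu : U ≤ u R) (hμ : μ ∈ klWindowC) {N : ℕ} (hK : FrameOK R U N μ K)
    (hβm : klBetaMin ≤ β) (hβL : β ≤ L) (n : ℕ) {j : ℕ} (hj : n + 1 ≤ j) (hj'β : π / (4 * β) ≤ klScale klE0 (n + 1)) {t : ℝ} (ht : t ∈ Icc (0 : ℝ) 1)
    (hGδ : (4 + 8 / 3 * R.Gfr 1 * U ^ 2) * (2 * π / L) ≤ klScale klE0 (n + 1))
    (hE0 : 2 * klScale klE0 n + (4 + 8 / 3 * R.Gfr 1 * U ^ 2) * (2 * π / L) ≤ klE0) (x : TorusSite 2 L)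
    (ρ : TorusSite 2 L → ℝ) (hρ : ∀ c, 0 ≤ ρ c) {η₀ Aw Z : ℝ} (hη₀ : η₀ ≤ klScale klE0 (n + 1))
    (hmass : ∀ η : ℝ, η₀ ≤ η → ∑ c ∈ univ.filter (fun c : TorusSite 2 L => klTorusNorm L (c - x) ≤ η), ρ c ≤ Aw * η) (hZ : ∑ c, ρ c ≤ Z) (I : ℕ) :
    ∑ c : TorusSite 2 L, ρ c * ((klScale klE0 n - klScale klE0 (n + 1)) * ((β * (L : ℝ) ^ 2) ^ 3)⁻¹ *
      ∑ p : FreqMomentum L M, ∑ _σ : Fin 2, ∑ p' : FreqMomentum L M,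
        (if matsubaraInt M p'.1 + matsubaraInt M (omega0 M) = matsubaraInt M p.1 + matsubaraInt M (omega0 M) ∧ p'.2 = p.2 + x - c then
          ‖((((softSymbolCompl L M β μ K (n + 1) j p + (hubbardCutoffWeightCT L M β μ K (klScale klE0 (n + 1)) p -
                hubbardCutoffWeightCT L M β μ K (klScale klE0 n + t * (klScale klE0 (n + 1) - klScale klE0 n)) p) : ℝ)) : ℂ) *
                (((β * (L : ℝ) ^ 2 : ℝ) : ℂ) * propCT L M β μ K p)) *
              ((((deriv (fun Λ' : ℝ => hubbardCutoffWeightCT L M β μ K Λ' p') (klScale klE0 n + t * (klScale klE0 (n + 1) - klScale klE0 n)) : ℝ)) : ℂ) *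
                (((β * (L : ℝ) ^ 2 : ℝ) : ℂ) * propCT L M β μ K p')) +
            ((((deriv (fun Λ' : ℝ => hubbardCutoffWeightCT L M β μ K Λ' p) (klScale klE0 n + t * (klScale klE0 (n + 1) - klScale klE0 n)) : ℝ)) : ℂ) *
                (((β * (L : ℝ) ^ 2 : ℝ) : ℂ) * propCT L M β μ K p)) *
              ((((softSymbolCompl L M β μ K (n + 1) j p' + (hubbardCutoffWeightCT L M β μ K (klScale klE0 (n + 1)) p' -
                hubbardCutoffWeightCT L M β μ K (klScale klE0 n + t * (klScale klE0 (n + 1) - klScale klE0 n)) p') : ℝ)) : ℂ) *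
                (((β * (L : ℝ) ^ 2 : ℝ) : ℂ) * propCT L M β μ K p'))‖
        else 0)) ≤
      (2048 * 15367 : ℝ) * Aw * klScale klE0 (n + 1) + 512 / 3 * ((27 / (8 * π ^ 2)) * A * (16 / π) * (10 + 50 * (4 + 8 / 3 * R.Gfr 1 * U ^ 2) * β / L)) * (Real.sqrt 2 / 4 * ((2 : ℝ) ^ n)⁻¹) * Z +
        2 * Aw * ((512 / 3 * ((27 / (8 * π ^ 2)) * A * (16 / π) * (10 + 50 * (4 + 8 / 3 * R.Gfr 1 * U ^ 2) * β / L)) * (16384 * (4 + 8 / 3 * R.Gfr 1 * U ^ 2) ^ 2) + (2048 * 15367 : ℝ) / (8 * (4 + 8 / 3 * R.Gfr 1 * U ^ 2))) * klScale klE0 (n + 1)) * I +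
        (512 / 3 * ((27 / (8 * π ^ 2)) * A * (16 / π) * (10 + 50 * (4 + 8 / 3 * R.Gfr 1 * U ^ 2) * β / L)) * (16384 * (4 + 8 / 3 * R.Gfr 1 * U ^ 2) ^ 2) + (2048 * 15367 : ℝ) / (8 * (4 + 8 / 3 * R.Gfr 1 * U ^ 2))) * klScale klE0 (n + 1) * Z / (klScale klE0 (n + 1) * 2 ^ I) := by
  have hπ := Real.pi_pos
  have hβ : 0 < β := pos_of_klBetaMin_le hβm
  have hL : (0 : ℝ) < L := by exact_mod_cast Nat.pos_of_ne_zero (NeZero.ne L)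
  have hGfr : ∀ j, 0 ≤ R.Gfr j := hR.wf.2.2
  have hG1 : 0 ≤ R.Gfr 1 := hGfr 1
  have hG0 : 0 < 4 + 8 / 3 * R.Gfr 1 * U ^ 2 := by nlinarith [hGfr 1, sq_nonneg U]
  have hΛ1 : 0 < klScale klE0 (n + 1) := klth_klScale_pos (n + 1)
  refine klam_sum_mul_profile_le ρ (fun c : TorusSite 2 L => (klScale klE0 n - klScale klE0 (n + 1)) * ((β * (L : ℝ) ^ 2) ^ 3)⁻¹ *
        ∑ p : FreqMomentum L M, ∑ _σ : Fin 2, ∑ p' : FreqMomentum L M,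
          (if matsubaraInt M p'.1 + matsubaraInt M (omega0 M) = matsubaraInt M p.1 + matsubaraInt M (omega0 M) ∧ p'.2 = p.2 + x - c then
            ‖((((softSymbolCompl L M β μ K (n + 1) j p + (hubbardCutoffWeightCT L M β μ K (klScale klE0 (n + 1)) p -
                  hubbardCutoffWeightCT L M β μ K (klScale klE0 n + t * (klScale klE0 (n + 1) - klScale klE0 n)) p) : ℝ)) : ℂ) *
                  (((β * (L : ℝ) ^ 2 : ℝ) : ℂ) * propCT L M β μ K p)) *
                ((((deriv (fun Λ' : ℝ => hubbardCutoffWeightCT L M β μ K Λ' p') (klScale klE0 n + t * (klScale klE0 (n + 1) - klScale klE0 n)) : ℝ)) : ℂ) *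
                  (((β * (L : ℝ) ^ 2 : ℝ) : ℂ) * propCT L M β μ K p')) +
              ((((deriv (fun Λ' : ℝ => hubbardCutoffWeightCT L M β μ K Λ' p) (klScale klE0 n + t * (klScale klE0 (n + 1) - klScale klE0 n)) : ℝ)) : ℂ) *
                  (((β * (L : ℝ) ^ 2 : ℝ) : ℂ) * propCT L M β μ K p)) *
                ((((softSymbolCompl L M β μ K (n + 1) j p' + (hubbardCutoffWeightCT L M β μ K (klScale klE0 (n + 1)) p' -
                  hubbardCutoffWeightCT L M β μ K (klScale klE0 n + t * (klScale klE0 (n + 1) - klScale klE0 n)) p') : ℝ)) : ℂ) *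
                  (((β * (L : ℝ) ^ 2 : ℝ) : ℂ) * propCT L M β μ K p'))‖
          else 0)) (fun c : TorusSite 2 L => klTorusNorm L (c - x)) I hρ
    (by positivity) (by positivity) (by norm_num) hΛ1 hη₀ hmass hZ (fun c => Wd_member_row_flat_le β μ K hK hβm hβL n hj ht _ _) (fun c hc => ?_)
  have e : klTorusNorm L (c - x) = klTorusNorm L (x - c) := by rw [show x - c = -(c - x) by abel]; exact (klvr_klTorusNorm_neg _).symm
  rw [e] at hc
  simp only [e]
  exact Wd_member_row_le_div β μ K h hA hR hU hUu hμ hK hβm hβL n hj hj'β ht hGδ hE0 hc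

/-- **CONVOLVED member direct PH row, mirror** (`row(c,y)`, transfer `c − y`, window centre `y`). -/
theorem Wd_member_conv_le' {L M : ℕ} [NeZero L] [NeZero M] (β μ : ℝ) (K : TrigPolyC4v) {A : ℝ} {u : RenConsts → ℝ} (h : TwoShellFrameAreaAt A u)
    (hA : 0 ≤ A) {R : RenConsts} (hR : R.WF2) {U : ℝ} (hU : 0 < U) (hUu : U ≤ u R) (hμ : μ ∈ klWindowC) {N : ℕ} (hK : FrameOK R U N μ K)
    (hβm : klBetaMin ≤ β) (hβL : β ≤ L) (n : ℕ) {j : ℕ} (hj : n + 1 ≤ j) (hj'β : π / (4 * β) ≤ klScale klE0 (n + 1)) {t : ℝ} (ht : t ∈ Icc (0 : ℝ) 1)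
    (hGδ : (4 + 8 / 3 * R.Gfr 1 * U ^ 2) * (2 * π / L) ≤ klScale klE0 (n + 1))
    (hE0 : 2 * klScale klE0 n + (4 + 8 / 3 * R.Gfr 1 * U ^ 2) * (2 * π / L) ≤ klE0) (y : TorusSite 2 L)
    (ρ : TorusSite 2 L → ℝ) (hρ : ∀ c, 0 ≤ ρ c) {η₀ Aw Z : ℝ} (hη₀ : η₀ ≤ klScale klE0 (n + 1))
    (hmass : ∀ η : ℝ, η₀ ≤ η → ∑ c ∈ univ.filter (fun c : TorusSite 2 L => klTorusNorm L (c - y) ≤ η), ρ c ≤ Aw * η) (hZ : ∑ c, ρ c ≤ Z) (I : ℕ) :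
    ∑ c : TorusSite 2 L, ρ c * ((klScale klE0 n - klScale klE0 (n + 1)) * ((β * (L : ℝ) ^ 2) ^ 3)⁻¹ *
      ∑ p : FreqMomentum L M, ∑ _σ : Fin 2, ∑ p' : FreqMomentum L M,
        (if matsubaraInt M p'.1 + matsubaraInt M (omega0 M) = matsubaraInt M p.1 + matsubaraInt M (omega0 M) ∧ p'.2 = p.2 + c - y then
          ‖((((softSymbolCompl L M β μ K (n + 1) j p + (hubbardCutoffWeightCT L M β μ K (klScale klE0 (n + 1)) p -
                hubbardCutoffWeightCT L M β μ K (klScale klE0 n + t * (klScale klE0 (n + 1) - klScale klE0 n)) p) : ℝ)) : ℂ) *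
                (((β * (L : ℝ) ^ 2 : ℝ) : ℂ) * propCT L M β μ K p)) *
              ((((deriv (fun Λ' : ℝ => hubbardCutoffWeightCT L M β μ K Λ' p') (klScale klE0 n + t * (klScale klE0 (n + 1) - klScale klE0 n)) : ℝ)) : ℂ) *
                (((β * (L : ℝ) ^ 2 : ℝ) : ℂ) * propCT L M β μ K p')) +
            ((((deriv (fun Λ' : ℝ => hubbardCutoffWeightCT L M β μ K Λ' p) (klScale klE0 n + t * (klScale klE0 (n + 1) - klScale klE0 n)) : ℝ)) : ℂ) *
                (((β * (L : ℝ) ^ 2 : ℝ) : ℂ) * propCT L M β μ K p)) *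
              ((((softSymbolCompl L M β μ K (n + 1) j p' + (hubbardCutoffWeightCT L M β μ K (klScale klE0 (n + 1)) p' -
                hubbardCutoffWeightCT L M β μ K (klScale klE0 n + t * (klScale klE0 (n + 1) - klScale klE0 n)) p') : ℝ)) : ℂ) *
                (((β * (L : ℝ) ^ 2 : ℝ) : ℂ) * propCT L M β μ K p'))‖
        else 0)) ≤
      (2048 * 15367 : ℝ) * Aw * klScale klE0 (n + 1) + 512 / 3 * ((27 / (8 * π ^ 2)) * A * (16 / π) * (10 + 50 * (4 + 8 / 3 * R.Gfr 1 * U ^ 2) * β / L)) * (Real.sqrt 2 / 4 * ((2 : ℝ) ^ n)⁻¹) * Z +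
        2 * Aw * ((512 / 3 * ((27 / (8 * π ^ 2)) * A * (16 / π) * (10 + 50 * (4 + 8 / 3 * R.Gfr 1 * U ^ 2) * β / L)) * (16384 * (4 + 8 / 3 * R.Gfr 1 * U ^ 2) ^ 2) + (2048 * 15367 : ℝ) / (8 * (4 + 8 / 3 * R.Gfr 1 * U ^ 2))) * klScale klE0 (n + 1)) * I +
        (512 / 3 * ((27 / (8 * π ^ 2)) * A * (16 / π) * (10 + 50 * (4 + 8 / 3 * R.Gfr 1 * U ^ 2) * β / L)) * (16384 * (4 + 8 / 3 * R.Gfr 1 * U ^ 2) ^ 2) + (2048 * 15367 : ℝ) / (8 * (4 + 8 / 3 * R.Gfr 1 * U ^ 2))) * klScale klE0 (n + 1) * Z / (klScale klE0 (n + 1) * 2 ^ I) := by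
  have hπ := Real.pi_pos
  have hβ : 0 < β := pos_of_klBetaMin_le hβm
  have hL : (0 : ℝ) < L := by exact_mod_cast Nat.pos_of_ne_zero (NeZero.ne L)
  have hGfr : ∀ j, 0 ≤ R.Gfr j := hR.wf.2.2
  have hG1 : 0 ≤ R.Gfr 1 := hGfr 1
  have hG0 : 0 < 4 + 8 / 3 * R.Gfr 1 * U ^ 2 := by nlinarith [hGfr 1, sq_nonneg U]
  have hΛ1 : 0 < klScale klE0 (n + 1) := klth_klScale_pos (n + 1)
  refine klam_sum_mul_profile_le ρ (fun c : TorusSite 2 L => (klScale klE0 n - klScale klE0 (n + 1)) * ((β * (L : ℝ) ^ 2) ^ 3)⁻¹ *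
        ∑ p : FreqMomentum L M, ∑ _σ : Fin 2, ∑ p' : FreqMomentum L M,
          (if matsubaraInt M p'.1 + matsubaraInt M (omega0 M) = matsubaraInt M p.1 + matsubaraInt M (omega0 M) ∧ p'.2 = p.2 + c - y then
            ‖((((softSymbolCompl L M β μ K (n + 1) j p + (hubbardCutoffWeightCT L M β μ K (klScale klE0 (n + 1)) p -
                  hubbardCutoffWeightCT L M β μ K (klScale klE0 n + t * (klScale klE0 (n + 1) - klScale klE0 n)) p) : ℝ)) : ℂ) *
                  (((β * (L : ℝ) ^ 2 : ℝ) : ℂ) * propCT L M β μ K p)) *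
                ((((deriv (fun Λ' : ℝ => hubbardCutoffWeightCT L M β μ K Λ' p') (klScale klE0 n + t * (klScale klE0 (n + 1) - klScale klE0 n)) : ℝ)) : ℂ) *
                  (((β * (L : ℝ) ^ 2 : ℝ) : ℂ) * propCT L M β μ K p')) +
              ((((deriv (fun Λ' : ℝ => hubbardCutoffWeightCT L M β μ K Λ' p) (klScale klE0 n + t * (klScale klE0 (n + 1) - klScale klE0 n)) : ℝ)) : ℂ) *
                  (((β * (L : ℝ) ^ 2 : ℝ) : ℂ) * propCT L M β μ K p)) *
                ((((softSymbolCompl L M β μ K (n + 1) j p' + (hubbardCutoffWeightCT L M β μ K (klScale klE0 (n + 1)) p' -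
                  hubbardCutoffWeightCT L M β μ K (klScale klE0 n + t * (klScale klE0 (n + 1) - klScale klE0 n)) p') : ℝ)) : ℂ) *
                  (((β * (L : ℝ) ^ 2 : ℝ) : ℂ) * propCT L M β μ K p'))‖
          else 0)) (fun c : TorusSite 2 L => klTorusNorm L (c - y)) I hρ
    (by positivity) (by positivity) (by norm_num) hΛ1 hη₀ hmass hZ (fun c => Wd_member_row_flat_le β μ K hK hβm hβL n hj ht _ _) (fun c hc => ?_)
  exact Wd_member_row_le_div β μ K h hA hR hU hUu hμ hK hβm hβL n hj hj'β ht hGδ hE0 hc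

/-- **CONVOLVED member crossed PH row** (transfer `x + c − Qm`, window centre `Qm − x`; constants `(256/3, 1024·15367)`). -/
theorem Wx_member_conv_le {L M : ℕ} [NeZero L] [NeZero M] (β μ : ℝ) (K : TrigPolyC4v) {A : ℝ} {u : RenConsts → ℝ} (h : TwoShellFrameAreaAt A u)
    (hA : 0 ≤ A) {R : RenConsts} (hR : R.WF2) {U : ℝ} (hU : 0 < U) (hUu : U ≤ u R) (hμ : μ ∈ klWindowC) {N : ℕ} (hK : FrameOK R U N μ K)
    (hβm : klBetaMin ≤ β) (hβL : β ≤ L) (n : ℕ) {j : ℕ} (hj : n + 1 ≤ j) (hj'β : π / (4 * β) ≤ klScale klE0 (n + 1)) {t : ℝ} (ht : t ∈ Icc (0 : ℝ) 1)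
    (hGδ : (4 + 8 / 3 * R.Gfr 1 * U ^ 2) * (2 * π / L) ≤ klScale klE0 (n + 1))
    (hE0 : 2 * klScale klE0 n + (4 + 8 / 3 * R.Gfr 1 * U ^ 2) * (2 * π / L) ≤ klE0) (Qm x : TorusSite 2 L)
    (ρ : TorusSite 2 L → ℝ) (hρ : ∀ c, 0 ≤ ρ c) {η₀ Aw Z : ℝ} (hη₀ : η₀ ≤ klScale klE0 (n + 1))
    (hmass : ∀ η : ℝ, η₀ ≤ η → ∑ c ∈ univ.filter (fun c : TorusSite 2 L => klTorusNorm L (c - (Qm - x)) ≤ η), ρ c ≤ Aw * η) (hZ : ∑ c, ρ c ≤ Z) (I : ℕ) :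
    ∑ c : TorusSite 2 L, ρ c * ((klScale klE0 n - klScale klE0 (n + 1)) * ((β * (L : ℝ) ^ 2) ^ 3)⁻¹ *
      ∑ p : FreqMomentum L M, ∑ p' : FreqMomentum L M,
        (if matsubaraInt M p'.1 + matsubaraInt M (omega0 M) + matsubaraInt M (omega0 M) + 1 = matsubaraInt M p.1 ∧ p'.2 = p.2 + Qm - x - c then
          ‖((((softSymbolCompl L M β μ K (n + 1) j p + (hubbardCutoffWeightCT L M β μ K (klScale klE0 (n + 1)) p -
                hubbardCutoffWeightCT L M β μ K (klScale klE0 n + t * (klScale klE0 (n + 1) - klScale klE0 n)) p) : ℝ)) : ℂ) *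
                (((β * (L : ℝ) ^ 2 : ℝ) : ℂ) * propCT L M β μ K p)) *
              ((((deriv (fun Λ' : ℝ => hubbardCutoffWeightCT L M β μ K Λ' p') (klScale klE0 n + t * (klScale klE0 (n + 1) - klScale klE0 n)) : ℝ)) : ℂ) *
                (((β * (L : ℝ) ^ 2 : ℝ) : ℂ) * propCT L M β μ K p')) +
            ((((deriv (fun Λ' : ℝ => hubbardCutoffWeightCT L M β μ K Λ' p) (klScale klE0 n + t * (klScale klE0 (n + 1) - klScale klE0 n)) : ℝ)) : ℂ) *
                (((β * (L : ℝ) ^ 2 : ℝ) : ℂ) * propCT L M β μ K p)) *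
              ((((softSymbolCompl L M β μ K (n + 1) j p' + (hubbardCutoffWeightCT L M β μ K (klScale klE0 (n + 1)) p' -
                hubbardCutoffWeightCT L M β μ K (klScale klE0 n + t * (klScale klE0 (n + 1) - klScale klE0 n)) p') : ℝ)) : ℂ) *
                (((β * (L : ℝ) ^ 2 : ℝ) : ℂ) * propCT L M β μ K p'))‖
        else 0)) ≤
      (1024 * 15367 : ℝ) * Aw * klScale klE0 (n + 1) + 256 / 3 * ((27 / (8 * π ^ 2)) * A * (16 / π) * (10 + 50 * (4 + 8 / 3 * R.Gfr 1 * U ^ 2) * β / L)) * (Real.sqrt 2 / 4 * ((2 : ℝ) ^ n)⁻¹) * Z +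
        2 * Aw * ((256 / 3 * ((27 / (8 * π ^ 2)) * A * (16 / π) * (10 + 50 * (4 + 8 / 3 * R.Gfr 1 * U ^ 2) * β / L)) * (16384 * (4 + 8 / 3 * R.Gfr 1 * U ^ 2) ^ 2) + (1024 * 15367 : ℝ) / (8 * (4 + 8 / 3 * R.Gfr 1 * U ^ 2))) * klScale klE0 (n + 1)) * I +
        (256 / 3 * ((27 / (8 * π ^ 2)) * A * (16 / π) * (10 + 50 * (4 + 8 / 3 * R.Gfr 1 * U ^ 2) * β / L)) * (16384 * (4 + 8 / 3 * R.Gfr 1 * U ^ 2) ^ 2) + (1024 * 15367 : ℝ) / (8 * (4 + 8 / 3 * R.Gfr 1 * U ^ 2))) * klScale klE0 (n + 1) * Z / (klScale klE0 (n + 1) * 2 ^ I) := by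
  have hπ := Real.pi_pos
  have hβ : 0 < β := pos_of_klBetaMin_le hβm
  have hL : (0 : ℝ) < L := by exact_mod_cast Nat.pos_of_ne_zero (NeZero.ne L)
  have hGfr : ∀ j, 0 ≤ R.Gfr j := hR.wf.2.2
  have hG1 : 0 ≤ R.Gfr 1 := hGfr 1
  have hG0 : 0 < 4 + 8 / 3 * R.Gfr 1 * U ^ 2 := by nlinarith [hGfr 1, sq_nonneg U]
  have hΛ1 : 0 < klScale klE0 (n + 1) := klth_klScale_pos (n + 1)
  refine klam_sum_mul_profile_le ρ (fun c : TorusSite 2 L => (klScale klE0 n - klScale klE0 (n + 1)) * ((β * (L : ℝ) ^ 2) ^ 3)⁻¹ *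
        ∑ p : FreqMomentum L M, ∑ p' : FreqMomentum L M,
          (if matsubaraInt M p'.1 + matsubaraInt M (omega0 M) + matsubaraInt M (omega0 M) + 1 = matsubaraInt M p.1 ∧ p'.2 = p.2 + Qm - x - c then
            ‖((((softSymbolCompl L M β μ K (n + 1) j p + (hubbardCutoffWeightCT L M β μ K (klScale klE0 (n + 1)) p -
                  hubbardCutoffWeightCT L M β μ K (klScale klE0 n + t * (klScale klE0 (n + 1) - klScale klE0 n)) p) : ℝ)) : ℂ) *
                  (((β * (L : ℝ) ^ 2 : ℝ) : ℂ) * propCT L M β μ K p)) *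
                ((((deriv (fun Λ' : ℝ => hubbardCutoffWeightCT L M β μ K Λ' p') (klScale klE0 n + t * (klScale klE0 (n + 1) - klScale klE0 n)) : ℝ)) : ℂ) *
                  (((β * (L : ℝ) ^ 2 : ℝ) : ℂ) * propCT L M β μ K p')) +
              ((((deriv (fun Λ' : ℝ => hubbardCutoffWeightCT L M β μ K Λ' p) (klScale klE0 n + t * (klScale klE0 (n + 1) - klScale klE0 n)) : ℝ)) : ℂ) *
                  (((β * (L : ℝ) ^ 2 : ℝ) : ℂ) * propCT L M β μ K p)) *
                ((((softSymbolCompl L M β μ K (n + 1) j p' + (hubbardCutoffWeightCT L M β μ K (klScale klE0 (n + 1)) p' -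
                  hubbardCutoffWeightCT L M β μ K (klScale klE0 n + t * (klScale klE0 (n + 1) - klScale klE0 n)) p') : ℝ)) : ℂ) *
                  (((β * (L : ℝ) ^ 2 : ℝ) : ℂ) * propCT L M β μ K p'))‖
          else 0)) (fun c : TorusSite 2 L => klTorusNorm L (c - (Qm - x))) I hρ
    (by positivity) (by positivity) (by norm_num) hΛ1 hη₀ hmass hZ (fun c => Wx_member_row_flat_le β μ K hK hβm hβL n hj ht _ _ _) (fun c hc => ?_)
  have e : klTorusNorm L (c - (Qm - x)) = klTorusNorm L (x + c - Qm) := by rw [show c - (Qm - x) = x + c - Qm by abel]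
  rw [e] at hc
  simp only [e]
  exact Wx_member_row_le_div β μ K h hA hR hU hUu hμ hK hβm hβL n hj hj'β ht hGδ hE0 hc

/-- **CONVOLVED member crossed PH row, mirror** (`row(c,y)`, transfer `c + y − Qm`, window centre `Qm − y`). -/
theorem Wx_member_conv_le' {L M : ℕ} [NeZero L] [NeZero M] (β μ : ℝ) (K : TrigPolyC4v) {A : ℝ} {u : RenConsts → ℝ} (h : TwoShellFrameAreaAt A u)
    (hA : 0 ≤ A) {R : RenConsts} (hR : R.WF2) {U : ℝ} (hU : 0 < U) (hUu : U ≤ u R) (hμ : μ ∈ klWindowC) {N : ℕ} (hK : FrameOK R U N μ K)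
    (hβm : klBetaMin ≤ β) (hβL : β ≤ L) (n : ℕ) {j : ℕ} (hj : n + 1 ≤ j) (hj'β : π / (4 * β) ≤ klScale klE0 (n + 1)) {t : ℝ} (ht : t ∈ Icc (0 : ℝ) 1)
    (hGδ : (4 + 8 / 3 * R.Gfr 1 * U ^ 2) * (2 * π / L) ≤ klScale klE0 (n + 1))
    (hE0 : 2 * klScale klE0 n + (4 + 8 / 3 * R.Gfr 1 * U ^ 2) * (2 * π / L) ≤ klE0) (Qm y : TorusSite 2 L)
    (ρ : TorusSite 2 L → ℝ) (hρ : ∀ c, 0 ≤ ρ c) {η₀ Aw Z : ℝ} (hη₀ : η₀ ≤ klScale klE0 (n + 1))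
    (hmass : ∀ η : ℝ, η₀ ≤ η → ∑ c ∈ univ.filter (fun c : TorusSite 2 L => klTorusNorm L (c - (Qm - y)) ≤ η), ρ c ≤ Aw * η) (hZ : ∑ c, ρ c ≤ Z) (I : ℕ) :
    ∑ c : TorusSite 2 L, ρ c * ((klScale klE0 n - klScale klE0 (n + 1)) * ((β * (L : ℝ) ^ 2) ^ 3)⁻¹ *
      ∑ p : FreqMomentum L M, ∑ p' : FreqMomentum L M,
        (if matsubaraInt M p'.1 + matsubaraInt M (omega0 M) + matsubaraInt M (omega0 M) + 1 = matsubaraInt M p.1 ∧ p'.2 = p.2 + Qm - c - y then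
          ‖((((softSymbolCompl L M β μ K (n + 1) j p + (hubbardCutoffWeightCT L M β μ K (klScale klE0 (n + 1)) p -
                hubbardCutoffWeightCT L M β μ K (klScale klE0 n + t * (klScale klE0 (n + 1) - klScale klE0 n)) p) : ℝ)) : ℂ) *
                (((β * (L : ℝ) ^ 2 : ℝ) : ℂ) * propCT L M β μ K p)) *
              ((((deriv (fun Λ' : ℝ => hubbardCutoffWeightCT L M β μ K Λ' p') (klScale klE0 n + t * (klScale klE0 (n + 1) - klScale klE0 n)) : ℝ)) : ℂ) *
                (((β * (L : ℝ) ^ 2 : ℝ) : ℂ) * propCT L M β μ K p')) +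
            ((((deriv (fun Λ' : ℝ => hubbardCutoffWeightCT L M β μ K Λ' p) (klScale klE0 n + t * (klScale klE0 (n + 1) - klScale klE0 n)) : ℝ)) : ℂ) *
                (((β * (L : ℝ) ^ 2 : ℝ) : ℂ) * propCT L M β μ K p)) *
              ((((softSymbolCompl L M β μ K (n + 1) j p' + (hubbardCutoffWeightCT L M β μ K (klScale klE0 (n + 1)) p' -
                hubbardCutoffWeightCT L M β μ K (klScale klE0 n + t * (klScale klE0 (n + 1) - klScale klE0 n)) p') : ℝ)) : ℂ) *
                (((β * (L : ℝ) ^ 2 : ℝ) : ℂ) * propCT L M β μ K p'))‖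
        else 0)) ≤
      (1024 * 15367 : ℝ) * Aw * klScale klE0 (n + 1) + 256 / 3 * ((27 / (8 * π ^ 2)) * A * (16 / π) * (10 + 50 * (4 + 8 / 3 * R.Gfr 1 * U ^ 2) * β / L)) * (Real.sqrt 2 / 4 * ((2 : ℝ) ^ n)⁻¹) * Z +
        2 * Aw * ((256 / 3 * ((27 / (8 * π ^ 2)) * A * (16 / π) * (10 + 50 * (4 + 8 / 3 * R.Gfr 1 * U ^ 2) * β / L)) * (16384 * (4 + 8 / 3 * R.Gfr 1 * U ^ 2) ^ 2) + (1024 * 15367 : ℝ) / (8 * (4 + 8 / 3 * R.Gfr 1 * U ^ 2))) * klScale klE0 (n + 1)) * I +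
        (256 / 3 * ((27 / (8 * π ^ 2)) * A * (16 / π) * (10 + 50 * (4 + 8 / 3 * R.Gfr 1 * U ^ 2) * β / L)) * (16384 * (4 + 8 / 3 * R.Gfr 1 * U ^ 2) ^ 2) + (1024 * 15367 : ℝ) / (8 * (4 + 8 / 3 * R.Gfr 1 * U ^ 2))) * klScale klE0 (n + 1) * Z / (klScale klE0 (n + 1) * 2 ^ I) := by
  have hπ := Real.pi_pos
  have hβ : 0 < β := pos_of_klBetaMin_le hβm
  have hL : (0 : ℝ) < L := by exact_mod_cast Nat.pos_of_ne_zero (NeZero.ne L)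
  have hGfr : ∀ j, 0 ≤ R.Gfr j := hR.wf.2.2
  have hG1 : 0 ≤ R.Gfr 1 := hGfr 1
  have hG0 : 0 < 4 + 8 / 3 * R.Gfr 1 * U ^ 2 := by nlinarith [hGfr 1, sq_nonneg U]
  have hΛ1 : 0 < klScale klE0 (n + 1) := klth_klScale_pos (n + 1)
  refine klam_sum_mul_profile_le ρ (fun c : TorusSite 2 L => (klScale klE0 n - klScale klE0 (n + 1)) * ((β * (L : ℝ) ^ 2) ^ 3)⁻¹ *
        ∑ p : FreqMomentum L M, ∑ p' : FreqMomentum L M,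
          (if matsubaraInt M p'.1 + matsubaraInt M (omega0 M) + matsubaraInt M (omega0 M) + 1 = matsubaraInt M p.1 ∧ p'.2 = p.2 + Qm - c - y then
            ‖((((softSymbolCompl L M β μ K (n + 1) j p + (hubbardCutoffWeightCT L M β μ K (klScale klE0 (n + 1)) p -
                  hubbardCutoffWeightCT L M β μ K (klScale klE0 n + t * (klScale klE0 (n + 1) - klScale klE0 n)) p) : ℝ)) : ℂ) *
                  (((β * (L : ℝ) ^ 2 : ℝ) : ℂ) * propCT L M β μ K p)) *
                ((((deriv (fun Λ' : ℝ => hubbardCutoffWeightCT L M β μ K Λ' p') (klScale klE0 n + t * (klScale klE0 (n + 1) - klScale klE0 n)) : ℝ)) : ℂ) *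
                  (((β * (L : ℝ) ^ 2 : ℝ) : ℂ) * propCT L M β μ K p')) +
              ((((deriv (fun Λ' : ℝ => hubbardCutoffWeightCT L M β μ K Λ' p) (klScale klE0 n + t * (klScale klE0 (n + 1) - klScale klE0 n)) : ℝ)) : ℂ) *
                  (((β * (L : ℝ) ^ 2 : ℝ) : ℂ) * propCT L M β μ K p)) *
                ((((softSymbolCompl L M β μ K (n + 1) j p' + (hubbardCutoffWeightCT L M β μ K (klScale klE0 (n + 1)) p' -
                  hubbardCutoffWeightCT L M β μ K (klScale klE0 n + t * (klScale klE0 (n + 1) - klScale klE0 n)) p') : ℝ)) : ℂ) *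
                  (((β * (L : ℝ) ^ 2 : ℝ) : ℂ) * propCT L M β μ K p'))‖
          else 0)) (fun c : TorusSite 2 L => klTorusNorm L (c - (Qm - y))) I hρ
    (by positivity) (by positivity) (by norm_num) hΛ1 hη₀ hmass hZ (fun c => Wx_member_row_flat_le β μ K hK hβm hβL n hj ht _ _ _) (fun c hc => ?_)
  have e : klTorusNorm L (c - (Qm - y)) = klTorusNorm L (c + y - Qm) := by rw [show c - (Qm - y) = c + y - Qm by abel]
  rw [e] at hc
  simp only [e]
  exact Wx_member_row_le_div β μ K h hA hR hU hUu hμ hK hβm hβL n hj hj'β ht hGδ hE0 hc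

end Summit.HubbardSuperconductivity.HubbardSuperconductivity.Theorems.KLRegimeSplit

end
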